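import Summits.BirchSwinnertonDyer.Rank1Residual.WAll.TargetAdditiveAtThreePotSSIrrAtoms
import Summits.BirchSwinnertonDyer.Rank1Residual.O6.X4CongruenceAnchor
import HarnessLib
import HarnessLib.Audit.Tags

/-!
# Rung W-ALL of ladder BSD (D-0120) — row 2 at `p = 3`, the WILD RANK-ONE leaf SLICED along the
# habitat of route `UniversalToricDescent`: «`ρ̄_{E,3}` onto ∧ a semistable-at-`3` onto TWIN exists» /
# its complement / the twinless onto atom (cell `bsd-wall`, lane (2), seat `bsd-wall-ty-1`; new small
# file importing `WAll.TargetAdditiveAtThreePotSSIrrAtoms` and, for the tree predicate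
# `Rank1Residual.O6.ModPCongruent` (`E′[p] ≅ E[p]` as `Γ_ℚ`-modules), `Rank1Residual.O6.X4CongruenceAnchor`)

HONEST FRAMING (cell `bsd-wall`, run/shared/lean/pub/bsd-wall/; brief `WALL-BRIEF-v1.md` sha16
b966bf16da27706e §2): STATEMENTS AND BOOKKEEPING ONLY — nothing asserted, nothing booked, no named
fact, no published theorem restated; the three `@[conjecture] def`s below are OPEN obligations and
SLICES of the registered leaf `WAllExclAddWildRankOne` (`TargetAdditiveAtThreeCells.lean`; wild
additive `3`, non-CM, `r = 1`; `13 573` W-ALL residue classes of record, census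
`bsd-wall-census/ROW2-AT3-SUBBLOCKS-v1.md` 85b4c5522424eded: X3-reducible `9 376` + irreducible `4 197`
= onto `3 894` + 3Nn `193` + 3Ns `110`).

WHY THESE SLICES. The lane-3 route draft `route-BirchSwinnertonDyer-UniversalToricDescent` (seat
`bsd-wall-pss3`, rev 1, `--closes-target Summit.BirchSwinnertonDyer.WAllExclAddWildRankOne`) attacks the
sub-cell «`ρ̄_{E,3}` onto AND a semistable-at-`3` twin `E′/ℚ` with `E′[3] ≅ E[3]` and onto image exists»
(its kernel item `ToricKernelAtThree`, stmt-BirchSwinnertonDyer-20390's antecedent shape) and carries the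
rest of the leaf as ONE residual route item `WildRankOneOffCellAtThree` (stmt-BirchSwinnertonDyer-20388,
difficulty XL), whose mass mixes three populations with three different owners: the X3-reducible rows
(`9 376`; ISODESC / RESISO / `SchneiderFreeAdditiveX3` territory — ALREADY the landed atom
`WAllExclAddWildRankOneRed`), the irreducible non-onto rows (`303`; ALREADY the landed atom
`WAllExclAddWildRankOneIrrNotSurj`), and the onto rows WITHOUT a semistable onto twin (uncensused; the
route's own kit ask). This file puts that cut on the W-ALL books, VERBATIM in the route's spelling
(`W.HasSurjectiveModNGaloisRep 3`, `Rank1Residual.O6.ModPCongruent W' W 3`, `¬ Addv W' 3`), so that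
(i) the route may `--closes-target` the habitat leaf BY NAME with NO residual item, its deciding theorem
being `wAllExclAddWildRankOneSurjTwin_of_forall` applied to the kernel's conclusion; (ii) its present
residual item is a registered-shape leaf (`WAllExclAddWildRankOneOffSurjTwin` = item 20388 verbatim, so
a prover closes either from the other by `exact`); (iii) the genuinely new residual is ONE named atom,
`WAllExclAddWildRankOneSurjTwinless`, and the registry sees the wild rank-one leaf as the EXACT
conjunction of four atoms (twin cell, twinless onto, normaliser, reducible) — no «onto ⇒ irreducible»
input needed for that direction of bookkeeping.

| slice `Prop` (this file) | shape (all `∀ W [..] [..], ¬ W.HasCM → Additive.ClassO6 W 3 → W.analyticRank = 1 → … → BSDp W 3`) | classes |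
|---|---|---|
| `WAllExclAddWildRankOneSurjTwin` | `… → onto → (∃ semistable onto twin) → BSDp W 3` (the attacked cell) | `≤ 3 894` |
| `WAllExclAddWildRankOneOffSurjTwin` | `… → ¬ (onto ∧ ∃ semistable onto twin) → BSDp W 3` (= item 20388 VERBATIM) | `9 376 + 303 +` twinless |
| `WAllExclAddWildRankOneSurjTwinless` | `… → onto → ¬ (∃ semistable onto twin) → BSDp W 3` | uncensused |

* §1 the three slice `Prop`s;
* §2 glue (no mathematics; excluded middle only): `wAllExclAddWildRankOne_iff_surjTwin_offSurjTwin`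
  (leaf ⟺ cell ∧ off-cell, EXACT — the route's `closes` case split), `wAllExclAddWildRankOneSurj_iff_surjTwin_surjTwinless`
  (the landed onto atom ⟺ twin ∧ twinless, EXACT), `wAllExclAddWildRankOne_iff_twinAtoms` (leaf ⟺
  twin ∧ twinless ∧ normaliser ∧ reducible, EXACT), the off-cell leaf ⇐ reducible ∧ normaliser ∧
  twinless (unconditional) and conversely given «onto ⇒ irreducible» (`hsi`, displayed; discharged by
  the tree theorem `Literature.NumberTheory.EllipticCurves.hasIrreducibleModPGaloisRep_of_hasSurjectiveModNGaloisRep`,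
  deliberately not imported here, as in `TargetAdditiveAtThreePotSSImage.lean`), the cell leaf ⇐ the
  kernel's conclusion shape / ⇐ the onto atom / ⇐ the irreducible atom (`hsi`) / ⇐ the leaf / ⇐ `WAll`;
* §3 row 2 at `3` reassembled with the wild leaf read through the four atoms (registry keys for
  `Rank1Residual.WAll.wAll_of_slicedLeaves_primaryGZ`, by name).

References: `WAll/TargetAdditiveAtThreePotSSIrrAtoms.lean`, `WAll/TargetAdditiveAtThreePotSSImage.lean`,
`WAll/TargetAdditiveAtThreeCells.lean`; `Rank1Residual/O6/X4CongruenceAnchor.lean` (`ModPCongruent`);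
`Rank1Residual/Predicates.lean` (`Irr`, `Red`, `Surj`, `Addv`); route file
`Summits/BirchSwinnertonDyer/BirchSwinnertonDyer/Theses/UniversalToricDescent.lean` rev 1 (items 20388,
20390, `closes`); HOME `bsd-wall-pss3/Route.md`; [cite: Miller2011LMS, §1 and Def. 1.1] (the currency
`BSD(E,p)`); Serre (1972) §4 / [folklore] (mod-`p` congruence of curves).
-/

noncomputable section

open scoped Classical

open WeierstrassCurve Literature.NumberTheory.EllipticCurves
  Literature.NumberTheory.EllipticCurves.Rank1Residual Literature.NumberTheory.EllipticCurves.ModularForms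
open Summit.BirchSwinnertonDyer.Rank1Residual

set_option autoImplicit false

namespace Summit.BirchSwinnertonDyer

/-! ### §1. The wild rank-one leaf cut along «onto ∧ semistable onto twin» -/

/-- **Wild additive `3`, rank one, ON THE TWIN CELL (OPEN)**: non-CM, `Additive.ClassO6 W 3`, `r = 1`,
`ρ̄_{E,3}` onto `GL₂(𝔽₃)`, and there is a curve `E′/ℚ` (globally minimal model `W'`) with
`E′[3] ≅ E[3]` as `Γ_ℚ`-modules (`O6.ModPCongruent W' W 3`), NOT additive at `3` (`¬ Addv W' 3`:
good or multiplicative reduction) and onto mod-`3` image ⇒ `BSD(E,3)` — the attacked cell of route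
`UniversalToricDescent` (the conclusion of its kernel item `ToricKernelAtThree`, with the leaf's `¬CM`
binder displayed); at most the `3 894` onto classes of record, minus the twinless ones (uncensused).
[folklore] -/
@[conjecture] def WAllExclAddWildRankOneSurjTwin : Prop :=
  ∀ (W : WeierstrassCurve ℚ) [W.IsElliptic] [W.IsGloballyMinimal],
    ¬ W.HasCM → Additive.ClassO6 W 3 → W.analyticRank = 1 → W.HasSurjectiveModNGaloisRep 3 →
      (∃ (W' : WeierstrassCurve ℚ) (_ : W'.IsElliptic) (_ : W'.IsGloballyMinimal),
        O6.ModPCongruent W' W 3 ∧ ¬ Addv W' 3 ∧ W'.HasSurjectiveModNGaloisRep 3) → BSDp W 3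

/-- **Wild additive `3`, rank one, OFF THE TWIN CELL (OPEN)** — the statement of route item
`WildRankOneOffCellAtThree` (stmt-BirchSwinnertonDyer-20388) VERBATIM: non-CM, `Additive.ClassO6 W 3`,
`r = 1`, and NOT («onto» ∧ «a semistable-at-`3` onto twin exists») ⇒ `BSD(E,3)`. Mass of record: the
X3-reducible rows `9 376` (= `WAllExclAddWildRankOneRed`) + the irreducible non-onto rows `193 + 110`
(= `WAllExclAddWildRankOneIrrNotSurj`) + the twinless onto rows (= `WAllExclAddWildRankOneSurjTwinless`,
uncensused); see `wAllExclAddWildRankOneOffSurjTwin_iff_red_irrNotSurj_surjTwinless`. [folklore] -/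
@[conjecture] def WAllExclAddWildRankOneOffSurjTwin : Prop :=
  ∀ (W : WeierstrassCurve ℚ) [W.IsElliptic] [W.IsGloballyMinimal],
    ¬ W.HasCM → Additive.ClassO6 W 3 → W.analyticRank = 1 →
      ¬ (W.HasSurjectiveModNGaloisRep 3 ∧
          ∃ (W' : WeierstrassCurve ℚ) (_ : W'.IsElliptic) (_ : W'.IsGloballyMinimal),
            O6.ModPCongruent W' W 3 ∧ ¬ Addv W' 3 ∧ W'.HasSurjectiveModNGaloisRep 3) → BSDp W 3

/-- **Wild additive `3`, rank one, onto image, TWINLESS (OPEN)**: non-CM, `Additive.ClassO6 W 3`,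
`r = 1`, `ρ̄_{E,3}` onto, and NO curve `E′/ℚ` with `E′[3] ≅ E[3]`, semistable at `3`, onto image
⇒ `BSD(E,3)` — the part of the landed onto atom `WAllExclAddWildRankOneSurj` that the twin transport
cannot reach (which local `ρ̄|G_{ℚ₃}` of a wild curve admit a semistable rational lift is the route's
census/kit question; uncensused). [folklore] -/
@[conjecture] def WAllExclAddWildRankOneSurjTwinless : Prop :=
  ∀ (W : WeierstrassCurve ℚ) [W.IsElliptic] [W.IsGloballyMinimal],
    ¬ W.HasCM → Additive.ClassO6 W 3 → W.analyticRank = 1 → W.HasSurjectiveModNGaloisRep 3 →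
      (¬ ∃ (W' : WeierstrassCurve ℚ) (_ : W'.IsElliptic) (_ : W'.IsGloballyMinimal),
        O6.ModPCongruent W' W 3 ∧ ¬ Addv W' 3 ∧ W'.HasSurjectiveModNGaloisRep 3) → BSDp W 3

/-! ### §2. Glue (excluded middle only) -/

/-- **Wild rank one ⟺ twin cell ∧ off the twin cell** (excluded middle on «onto ∧ ∃ twin»; EXACT) —
the case split of the route's deciding theorem `closes`, now between two named leaves. [folklore] -/
theorem wAllExclAddWildRankOne_iff_surjTwin_offSurjTwin :
    WAllExclAddWildRankOne ↔ WAllExclAddWildRankOneSurjTwin ∧ WAllExclAddWildRankOneOffSurjTwin :=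
  ⟨fun h ↦ ⟨fun W _ _ hcm hO hr _ _ ↦ h W hcm hO hr, fun W _ _ hcm hO hr _ ↦ h W hcm hO hr⟩,
    fun ⟨hC, hF⟩ W _ _ hcm hO hr ↦ by
      by_cases hcell : (W.HasSurjectiveModNGaloisRep 3 ∧
          ∃ (W' : WeierstrassCurve ℚ) (_ : W'.IsElliptic) (_ : W'.IsGloballyMinimal),
            O6.ModPCongruent W' W 3 ∧ ¬ Addv W' 3 ∧ W'.HasSurjectiveModNGaloisRep 3)
      · exact hC W hcm hO hr hcell.1 hcell.2
      · exact hF W hcm hO hr hcell⟩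

/-- The wild rank-one leaf from the two slices. [folklore] -/
theorem wAllExclAddWildRankOne_of_surjTwin_of_offSurjTwin (hC : WAllExclAddWildRankOneSurjTwin)
    (hF : WAllExclAddWildRankOneOffSurjTwin) : WAllExclAddWildRankOne :=
  wAllExclAddWildRankOne_iff_surjTwin_offSurjTwin.2 ⟨hC, hF⟩

/-- Conversely the leaf restricts to both slices and to the twinless atom. [folklore] -/
theorem twinSlices_of_wAllExclAddWildRankOne (h : WAllExclAddWildRankOne) :
    WAllExclAddWildRankOneSurjTwin ∧ WAllExclAddWildRankOneOffSurjTwin ∧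
      WAllExclAddWildRankOneSurjTwinless :=
  ⟨fun W _ _ hcm hO hr _ _ ↦ h W hcm hO hr, fun W _ _ hcm hO hr _ ↦ h W hcm hO hr,
    fun W _ _ hcm hO hr _ _ ↦ h W hcm hO hr⟩

/-- **The landed onto atom ⟺ twin cell ∧ twinless** (excluded middle on «∃ twin»; EXACT). [folklore] -/
theorem wAllExclAddWildRankOneSurj_iff_surjTwin_surjTwinless :
    WAllExclAddWildRankOneSurj ↔
      WAllExclAddWildRankOneSurjTwin ∧ WAllExclAddWildRankOneSurjTwinless :=
  ⟨fun h ↦ ⟨fun W _ _ hcm hO hr hs _ ↦ h W hcm hO hs hr, fun W _ _ hcm hO hr hs _ ↦ h W hcm hO hs hr⟩,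
    fun ⟨hC, hL⟩ W _ _ hcm hO hs hr ↦ by
      by_cases htwin : ∃ (W' : WeierstrassCurve ℚ) (_ : W'.IsElliptic) (_ : W'.IsGloballyMinimal),
          O6.ModPCongruent W' W 3 ∧ ¬ Addv W' 3 ∧ W'.HasSurjectiveModNGaloisRep 3
      · exact hC W hcm hO hr hs htwin
      · exact hL W hcm hO hr hs htwin⟩

/-- The twin cell ⇐ the landed onto atom `WAllExclAddWildRankOneSurj` (it is a sub-case). [folklore] -/
theorem wAllExclAddWildRankOneSurjTwin_of_surj (h : WAllExclAddWildRankOneSurj) :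
    WAllExclAddWildRankOneSurjTwin :=
  (wAllExclAddWildRankOneSurj_iff_surjTwin_surjTwinless.1 h).1

/-- The twinless atom ⇐ the landed onto atom. [folklore] -/
theorem wAllExclAddWildRankOneSurjTwinless_of_surj (h : WAllExclAddWildRankOneSurj) :
    WAllExclAddWildRankOneSurjTwinless :=
  (wAllExclAddWildRankOneSurj_iff_surjTwin_surjTwinless.1 h).2

/-- The twin cell ⇐ the irreducible atom `WAllExclAddWildRankOneIrr`, given «onto ⇒ irreducible»
(`hsi`, the tree theorem `hasIrreducibleModPGaloisRep_of_hasSurjectiveModNGaloisRep` at `3`). [folklore] -/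
theorem wAllExclAddWildRankOneSurjTwin_of_irr
    (hsi : ∀ (W : WeierstrassCurve ℚ) [W.IsElliptic], Surj W 3 → Irr W 3)
    (h : WAllExclAddWildRankOneIrr) : WAllExclAddWildRankOneSurjTwin :=
  fun W _ _ hcm hO hr hs _ ↦ h W hcm hO (hsi W hs) hr

/-- **The twin cell ⇐ the kernel's conclusion shape** — the antecedent-free form of route item
`ToricKernelAtThree`'s conclusion (no `¬CM` binder there): this is the one line by which the route's
deciding theorem would conclude the habitat leaf BY NAME if it `--closes-target`s it. [folklore] -/
theorem wAllExclAddWildRankOneSurjTwin_of_forall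
    (h : ∀ (W : WeierstrassCurve ℚ) [W.IsElliptic] [W.IsGloballyMinimal],
      Additive.ClassO6 W 3 → W.analyticRank = 1 → W.HasSurjectiveModNGaloisRep 3 →
        (∃ (W' : WeierstrassCurve ℚ) (_ : W'.IsElliptic) (_ : W'.IsGloballyMinimal),
          O6.ModPCongruent W' W 3 ∧ ¬ Addv W' 3 ∧ W'.HasSurjectiveModNGaloisRep 3) → BSDp W 3) :
    WAllExclAddWildRankOneSurjTwin :=
  fun W _ _ _ hO hr hs htwin ↦ h W hO hr hs htwin

/-- **Off the twin cell ⇐ reducible atom ∧ normaliser atom ∧ twinless atom** (excluded middle on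
`Surj W 3` and on `Irr W 3`; unconditional). [folklore] -/
theorem wAllExclAddWildRankOneOffSurjTwin_of_red_of_irrNotSurj_of_surjTwinless
    (hR : WAllExclAddWildRankOneRed) (hN : WAllExclAddWildRankOneIrrNotSurj)
    (hL : WAllExclAddWildRankOneSurjTwinless) : WAllExclAddWildRankOneOffSurjTwin :=
  fun W _ _ hcm hO hr hcell ↦ by
    by_cases hs : Surj W 3
    · exact hL W hcm hO hr hs (fun htwin ↦ hcell ⟨hs, htwin⟩)
    · by_cases hirr : Irr W 3
      · exact hN W hcm hO hirr hs hr
      · exact hR W hcm hO hirr hr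

/-- Off the twin cell restricts to the twinless atom (unconditional). [folklore] -/
theorem wAllExclAddWildRankOneSurjTwinless_of_offSurjTwin (h : WAllExclAddWildRankOneOffSurjTwin) :
    WAllExclAddWildRankOneSurjTwinless :=
  fun W _ _ hcm hO hr _ htw ↦ h W hcm hO hr (fun hcell ↦ htw hcell.2)

/-- Off the twin cell restricts to the normaliser atom (unconditional). [folklore] -/
theorem wAllExclAddWildRankOneIrrNotSurj_of_offSurjTwin (h : WAllExclAddWildRankOneOffSurjTwin) :
    WAllExclAddWildRankOneIrrNotSurj :=
  fun W _ _ hcm hO _ hs hr ↦ h W hcm hO hr (fun hcell ↦ hs hcell.1)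

/-- Off the twin cell restricts to the reducible atom, given «onto ⇒ irreducible» (`hsi`). [folklore] -/
theorem wAllExclAddWildRankOneRed_of_offSurjTwin
    (hsi : ∀ (W : WeierstrassCurve ℚ) [W.IsElliptic], Surj W 3 → Irr W 3)
    (h : WAllExclAddWildRankOneOffSurjTwin) : WAllExclAddWildRankOneRed :=
  fun W _ _ hcm hO hred hr ↦ h W hcm hO hr (fun hcell ↦ (show ¬ Irr W 3 from hred) (hsi W hcell.1))

/-- **Off the twin cell ⟺ reducible ∧ normaliser ∧ twinless** (given `hsi` for one direction): the
route's XL residual item is the conjunction of two LANDED atoms and ONE new atom. [folklore] -/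
theorem wAllExclAddWildRankOneOffSurjTwin_iff_red_irrNotSurj_surjTwinless
    (hsi : ∀ (W : WeierstrassCurve ℚ) [W.IsElliptic], Surj W 3 → Irr W 3) :
    WAllExclAddWildRankOneOffSurjTwin ↔
      WAllExclAddWildRankOneRed ∧ WAllExclAddWildRankOneIrrNotSurj ∧
        WAllExclAddWildRankOneSurjTwinless :=
  ⟨fun h ↦ ⟨wAllExclAddWildRankOneRed_of_offSurjTwin hsi h,
      wAllExclAddWildRankOneIrrNotSurj_of_offSurjTwin h,
      wAllExclAddWildRankOneSurjTwinless_of_offSurjTwin h⟩,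
    fun ⟨hR, hN, hL⟩ ↦
      wAllExclAddWildRankOneOffSurjTwin_of_red_of_irrNotSurj_of_surjTwinless hR hN hL⟩

/-- **Wild rank one ⟺ twin cell ∧ twinless onto ∧ normaliser ∧ reducible** (EXACT, no `hsi`): the
registry reads the leaf as four atoms, three of them residual to the route. [folklore] -/
theorem wAllExclAddWildRankOne_iff_twinAtoms :
    WAllExclAddWildRankOne ↔
      WAllExclAddWildRankOneSurjTwin ∧ WAllExclAddWildRankOneSurjTwinless ∧
        WAllExclAddWildRankOneIrrNotSurj ∧ WAllExclAddWildRankOneRed :=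
  ⟨fun h ↦ ⟨fun W _ _ hcm hO hr _ _ ↦ h W hcm hO hr, fun W _ _ hcm hO hr _ _ ↦ h W hcm hO hr,
      fun W _ _ hcm hO _ _ hr ↦ h W hcm hO hr, fun W _ _ hcm hO _ hr ↦ h W hcm hO hr⟩,
    fun ⟨hC, hL, hN, hR⟩ ↦
      wAllExclAddWildRankOne_of_surjTwin_of_offSurjTwin hC
        (wAllExclAddWildRankOneOffSurjTwin_of_red_of_irrNotSurj_of_surjTwinless hR hN hL)⟩

/-- The wild rank-one leaf from the four atoms. [folklore] -/
theorem wAllExclAddWildRankOne_of_twinAtoms (hC : WAllExclAddWildRankOneSurjTwin)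
    (hL : WAllExclAddWildRankOneSurjTwinless) (hN : WAllExclAddWildRankOneIrrNotSurj)
    (hR : WAllExclAddWildRankOneRed) : WAllExclAddWildRankOne :=
  wAllExclAddWildRankOne_iff_twinAtoms.2 ⟨hC, hL, hN, hR⟩

/-- The three slices follow from `WAll` (each is an instance of it). [folklore] -/
theorem twinSlices_of_wAll (h : WAll) :
    WAllExclAddWildRankOneSurjTwin ∧ WAllExclAddWildRankOneOffSurjTwin ∧
      WAllExclAddWildRankOneSurjTwinless :=
  twinSlices_of_wAllExclAddWildRankOne (cellsAtThree_of_wAll h).2.2.2.2.2.2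

/-! ### §3. Row 2 at `3` reassembled with the wild leaf read through the twin atoms (registry keys) -/

/-- **Row 2 at `3`, rank one ⇐ the type-keyed menu with the wild leaf as four atoms**: (M)@3.r1,
(G-ord)@3.r1, O5@3.r1, twin cell, twinless onto, normaliser, reducible. [folklore] -/
theorem wAllExclAdditiveAtThreeRankOne_of_cells_of_twinAtoms
    (hM : WAllExclAddPotMultAtThreeRankOne) (hG : WAllExclAddPotOrdAtThreeRankOne)
    (hT : WAllExclAddTameSSAtThreeRankOne) (hC : WAllExclAddWildRankOneSurjTwin)
    (hL : WAllExclAddWildRankOneSurjTwinless) (hN : WAllExclAddWildRankOneIrrNotSurj)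
    (hR : WAllExclAddWildRankOneRed) : WAllExclAdditiveAtThreeRankOne :=
  wAllExclAdditiveAtThreeRankOne_iff_cells.2
    ⟨hM, hG, hT, wAllExclAddWildRankOne_of_twinAtoms hC hL hN hR⟩

/-- **Row 2 at `3` (`WAllExclAdditiveAtThree`, the registered slice) ⇐ (M)@3, (G-ord)@3, the rank-`0`
potentially supersingular block, O5@3.r1 and the four wild atoms** — feed the result as `h3` of
`Rank1Residual.WAll.wAll_of_slicedLeaves_primaryGZ`. [folklore] -/
theorem wAllExclAdditiveAtThree_of_k1Cells_of_potSSRankZero_of_tame_of_twinAtoms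
    (hM : WAllExclAddPotMultAtThree) (hG : WAllExclAddPotOrdAtThree) (h0 : WAllExclAddPotSSAtThreeRankZero)
    (hT : WAllExclAddTameSSAtThreeRankOne) (hC : WAllExclAddWildRankOneSurjTwin)
    (hL : WAllExclAddWildRankOneSurjTwinless) (hN : WAllExclAddWildRankOneIrrNotSurj)
    (hR : WAllExclAddWildRankOneRed) : WAllExclAdditiveAtThree :=
  wAllExclAdditiveAtThree_of_k1Cells_of_potSSRankZero_of_tame_of_wildRed_of_wildIrr hM hG h0 hT hR
    (wAllExclAddWildRankOneIrr_of_surj_of_irrNotSurj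
      (wAllExclAddWildRankOneSurj_iff_surjTwin_surjTwinless.2 ⟨hC, hL⟩) hN)

/-- Conversely row 2 at `3` restricts to the three slices. [folklore] -/
theorem twinSlices_of_wAllExclAdditiveAtThree (h : WAllExclAdditiveAtThree) :
    WAllExclAddWildRankOneSurjTwin ∧ WAllExclAddWildRankOneOffSurjTwin ∧
      WAllExclAddWildRankOneSurjTwinless :=
  twinSlices_of_wAllExclAddWildRankOne
    (wAllExclAddWildRankOne_iff_red_irr.2
      ⟨(irrMenus_of_wAllExclAdditiveAtThree h).2.2.1, (irrMenus_of_wAllExclAdditiveAtThree h).2.2.2.1⟩)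

end Summit.BirchSwinnertonDyer

end
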